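import Mathlib

/-!
# `FeketeSOS.FeketeNoSparseSplit` (stmt-ValiantsHypothesis-3997), line `cyclic-valuation-dichotomy` — stub `stub_charPFewnomial`

Char-`p` fewnomial bound (minimum distance `m+1` of the repeated-root cyclic code `⟨(x-1)^m⟩` of length `p`,
Castagnoli–Massey–Schoeller–von Seemann, IEEE Trans. Inform. Theory 37 (1991) Thm 1; "char-`p` Hajós lemma"):
over a field `K` of characteristic `p`, a non-zero polynomial of degree `< p` divisible by `(X-1)^m` has at least
`m + 1` monomials.  Elementary proof by induction on `m` with the operator `X·d/dX - e` (which deletes the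
monomial `X^e`, keeps all other monomials because exponents `< p` are distinct in `K`, and lowers the
`(X-1)`-order by at most one).
-/

namespace Summit.ValiantsHypothesis.ValiantsHypothesis.Theorems.FeketeNoSparseSplitCyclic

open Polynomial

-- `Summit.ValiantsHypothesis.ValiantsHypothesis.…` is the tree's mandated single-conjunct layout (Sub = Summit).
set_option linter.dupNamespace false

/-- Coefficient formula for the Euler-type operator `X·d/dX - e`: it multiplies the `n`-th coefficient
by `n - e`. -/
theorem cpf_coeff_op {K : Type} [CommRing K] (g : K[X]) (e : K) (n : ℕ) :
    (X * derivative g - C e * g).coeff n = ((n : K) - e) * g.coeff n := by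
  rcases n with _ | n
  · simp
  · rw [coeff_sub, coeff_X_mul, coeff_derivative, coeff_C_mul]
    push_cast
    ring

/-- In characteristic `p`, if `deg g < p` and `e < p`, the operator `X·d/dX - e` kills exactly the monomial
`X^e` of `g` and no other. -/
theorem cpf_support_op {K : Type} [Field K] (p : ℕ) [CharP K p] (g : K[X]) (hdeg : g.natDegree < p)
    (e : ℕ) (he : e < p) :
    (X * derivative g - C (e : K) * g).support = g.support.erase e := by
  ext n
  simp only [mem_support_iff, Finset.mem_erase, cpf_coeff_op, ne_eq, mul_eq_zero, not_or, sub_eq_zero]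
  constructor
  · rintro ⟨hne, hg⟩
    exact ⟨fun h => hne (by rw [h]), hg⟩
  · rintro ⟨hne, hg⟩
    refine ⟨fun h => hne ?_, hg⟩
    have hn : n < p := lt_of_le_of_lt (le_natDegree_of_ne_zero hg) hdeg
    exact CharP.natCast_injOn_Iio K p hn he h

/-- **Char-`p` fewnomial bound**, induction form: over a field of characteristic `p`, a non-zero `g` with
`deg g < p` and `(X - 1)^m ∣ g` has at least `m + 1` monomials. -/
theorem cpf_main (K : Type) [Field K] (p : ℕ) [CharP K p] (m : ℕ) :
    ∀ g : K[X], g ≠ 0 → g.natDegree < p → (X - C (1 : K)) ^ m ∣ g → m + 1 ≤ g.support.card := by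
  induction m with
  | zero =>
    intro g hg _ _
    simpa using Finset.card_pos.2 (support_nonempty.2 hg)
  | succ m ih =>
    intro g hg hdeg hdvd
    -- the exponent to be deleted
    set e := g.natDegree with he_def
    have he : e ∈ g.support := natDegree_mem_support_of_nonzero hg
    -- the Euler-type operator applied to `g`
    set h := X * derivative g - C (e : K) * g with hh_def
    have hsupp : h.support = g.support.erase e := cpf_support_op p g hdeg e hdeg
    have hcard : h.support.card + 1 = g.support.card := by
      rw [hsupp]
      exact Finset.card_erase_add_one he
    -- `(X - 1)^m ∣ h`
    have hdvd' : (X - C 1) ^ m ∣ h := by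
      have h1 : (X - C 1) ^ m ∣ derivative g := by
        simpa using pow_sub_one_dvd_derivative_of_pow_dvd hdvd
      exact dvd_sub (dvd_mul_of_dvd_right h1 _)
        (dvd_mul_of_dvd_right ((pow_dvd_pow _ m.le_succ).trans hdvd) _)
    by_cases hz : h = 0
    · -- then `g` is a single monomial, which cannot vanish at `1` unless it is zero
      exfalso
      have hle : g.support.card ≤ 1 := by
        have h0 : (g.support.erase e).card = 0 := by
          rw [← hsupp, hz, support_zero, Finset.card_empty]
        rw [Finset.card_erase_of_mem he] at h0
        omega
      obtain ⟨n, a, hga⟩ := card_support_le_one_iff_monomial.1 hle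
      have h1 : X - C 1 ∣ monomial n a := hga ▸ (dvd_pow_self _ (Nat.succ_ne_zero m)).trans hdvd
      rw [dvd_iff_isRoot, IsRoot, eval_monomial, one_pow, mul_one] at h1
      exact hg (by rw [hga, h1, monomial_zero_right])
    · have hdeg' : h.natDegree < p := by
        refine lt_of_le_of_lt (natDegree_le_natDegree (degree_mono ?_)) hdeg
        rw [hsupp]
        exact Finset.erase_subset _ _
      have := ih h hz hdeg' hdvd'
      omega

/-- **Char-`p` fewnomial bound.**  Over a field `K` of characteristic `p`, a non-zero polynomial `g` of degree
`< p` divisible by `(X - 1)^m` has at least `m + 1` monomials. [folklore] -/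
theorem stub_charPFewnomial :
    ∀ (K : Type) [Field K] (p : ℕ) [Fact p.Prime] [CharP K p] (g : K[X]) (m : ℕ),
      g ≠ 0 → g.natDegree < p → (X - C (1 : K)) ^ m ∣ g → m + 1 ≤ g.support.card :=
  fun K _ p _ _ g m => cpf_main K p m g

end Summit.ValiantsHypothesis.ValiantsHypothesis.Theorems.FeketeNoSparseSplitCyclic
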